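import Summits.AtomisticToContinuum.FouriersLaw.Theses.HiddenChargeMazur
import Summits.AtomisticToContinuum.FouriersLaw.Theorems.HiddenChargeMazurDressedChargeOfNoLocalIntegrals
import Summits.AtomisticToContinuum.FouriersLaw.Theorems.HiddenChargeMazurDressedChargeStubAlgebraize
import Summits.AtomisticToContinuum.FouriersLaw.Theorems.HiddenChargeMazurDressedChargeStubWindowForm
import Summits.AtomisticToContinuum.FouriersLaw.Theorems.HiddenChargeMazurDressedChargeStubPlaneWaveLink
import Summits.AtomisticToContinuum.FouriersLaw.Theorems.HiddenChargeMazurDressedChargeStubHarmonicSymmetries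
import Summits.AtomisticToContinuum.FouriersLaw.Theorems.HiddenChargeMazurDressedChargeStubSeedLink
import Summits.AtomisticToContinuum.FouriersLaw.Theorems.HiddenChargeMazurDressedChargeStubSeedObstruction
import Summits.AtomisticToContinuum.FouriersLaw.Theorems.HiddenChargeMazurDressedChargeStubMainReduction
import HarnessLib

/-!
# `DressedCharge` (crux stmt-AtomisticToContinuum-13509 of route `HiddenChargeMazur`, sub-problem
# `FouriersLaw`) — PROVED

The crux is the conditional "IF the infinite pinned anharmonic chain `pinnedChain ω₂ lam β γ` (all
parameters `> 0`) carries a momentum-odd polynomial local conserved density with extensive static current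
overlap THEN dressed test functions exist". It holds VACUOUSLY: by the classification theorem
`oddChargeCoboundary` below, every momentum-odd POLYNOMIAL local conservation law of the chain is the
shift-coboundary of a polynomial `2R`-site profile, whose bulk charge telescopes to two boundary blocks with
sub-extensive current overlap (`dressedCharge_of_oddChargeCoboundary`, in the tree), contradicting the
overlap clause of the hypothesis.

The classification (line `birth` of the crux, seven stubs, all landed under
`Theorems/HiddenChargeMazurDressedCharge*`): algebraization in the lattice polynomial ring
`MvPolynomial (ℤ ⊕ ℤ) ℝ` (A), discrete Euler operators and the linearised equation `L (L u) + 𝒲 u = 0` for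
the even characteristic `u = E_p G`, exactness of the lattice variational complex and the total-degree
filtration around the harmonic chain (G), harmonic rigidity by complex plane-wave derivations (C, D), the
first anharmonic obstruction killing the seed `u₁ = Σ a_m q_m` along the nontrivial resonance branch of the
4-phonon process `(k₁,k₂) → (k₁+k₂, 0)` (E, F), and the window form (B).
-/

noncomputable section

namespace Summit.AtomisticToContinuum.FouriersLaw.Theorems

open MeasureTheory
open Literature.MathematicalPhysics.KineticTheory.HeatConduction

/-- **Classification of odd polynomial local conservation laws of the pinned anharmonic chain.** For
`pinnedChain ω₂ lam β γ` with all parameters `> 0`, every momentum-odd polynomial range-`R` density `g`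
carrying a polynomial local conservation law of the infinite chain is the shift-coboundary of a polynomial
`2R`-site profile: `g(y₀…y_{2R}) = k(y₁…y_{2R}) − k(y₀…y_{2R−1})`. -/
theorem oddChargeCoboundary :
    ∀ ω₂ lam β γ : ℝ, 0 < ω₂ → 0 < lam → 0 < β → 0 < γ →
    ∀ P : OscillatorChain, P = pinnedChain ω₂ lam β γ →
    ∀ (R : ℕ) (g : (Fin (2 * R + 1) → ℝ × ℝ) → ℝ) (ψ : (Fin (2 * (R + 1) + 1) → ℝ × ℝ) → ℝ),
      (∃ p : MvPolynomial (Fin (2 * R + 1) ⊕ Fin (2 * R + 1)) ℝ, ∀ y : Fin (2 * R + 1) → ℝ × ℝ, g y = MvPolynomial.eval (Sum.elim (fun i => (y i).1) (fun i => (y i).2)) p) →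
      (∃ p : MvPolynomial (Fin (2 * (R + 1) + 1) ⊕ Fin (2 * (R + 1) + 1)) ℝ, ∀ y : Fin (2 * (R + 1) + 1) → ℝ × ℝ, ψ y = MvPolynomial.eval (Sum.elim (fun i => (y i).1) (fun i => (y i).2)) p) →
      (∀ y : Fin (2 * R + 1) → ℝ × ℝ, g (fun i => ((y i).1, -(y i).2)) = -g y) →
      (∀ σ : ℤ → ℝ × ℝ, (∑' x : ℤ, ((σ x).2 * deriv (fun t => g (fun i : Fin (2 * R + 1) => Function.update σ x (t, (σ x).2) ((i : ℤ) - (R : ℕ)))) (σ x).1 + (-deriv P.U (σ x).1 + (deriv P.V ((σ (x + 1)).1 - (σ x).1) - deriv P.V ((σ x).1 - (σ (x - 1)).1))) * deriv (fun t => g (fun i : Fin (2 * R + 1) => Function.update σ x ((σ x).1, t) ((i : ℤ) - (R : ℕ)))) (σ x).2)) = ψ (fun i : Fin (2 * (R + 1) + 1) => σ ((i : ℤ) - (R + 1 : ℕ))) - ψ (fun i : Fin (2 * (R + 1) + 1) => σ ((i : ℤ) - (R + 1 : ℕ) + 1))) →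
      ∃ k : (Fin (2 * R) → ℝ × ℝ) → ℝ,
        (∃ p : MvPolynomial (Fin (2 * R) ⊕ Fin (2 * R)) ℝ, ∀ w : Fin (2 * R) → ℝ × ℝ, k w = MvPolynomial.eval (Sum.elim (fun i => (w i).1) (fun i => (w i).2)) p) ∧
        ∀ y : Fin (2 * R + 1) → ℝ × ℝ, g y = k (fun i => y i.succ) - k (fun i => y (Fin.castSucc i)) := by
  intro ω₂ lam β γ hω hl hβ _hγ P hP R g ψ hg hψ hodd hlaw
  obtain ⟨G, Ψ, hvars, heval, hΘ, hL⟩ := DressedCharge.stub_algebraize ω₂ lam β γ P hP R g ψ hg hψ hodd hlaw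
  obtain ⟨c, H, hGH⟩ := DressedCharge.stub_mainReduction ω₂ lam β hω hl hβ G Ψ hΘ hL
  exact DressedCharge.stub_windowForm R g G H c hvars heval hodd hGH

/-- **`DressedCharge` holds** (crux stmt-AtomisticToContinuum-13509 of route `HiddenChargeMazur`): by the
classification `oddChargeCoboundary` and the in-tree vacuity composition
`DressedCharge.dressedCharge_of_oddChargeCoboundary`. -/
theorem dressedCharge_proof :
    Summit.AtomisticToContinuum.FouriersLaw.Theses.HiddenChargeMazur.DressedCharge :=
  DressedCharge.dressedCharge_of_oddChargeCoboundary oddChargeCoboundary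

end Summit.AtomisticToContinuum.FouriersLaw.Theorems

end
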